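import Mathlib
import Literature.Geometry.DiscreteGeometry.CrystallographicGroups
import Summits.AtomisticToContinuum.Crystallization.Theorems.IsometryAtomsMinimisingLawsCohesiveGroupStructureAux1

/-!
# Sub-goal `groupStructure_fixedPoint_of_finite` of stub `stub_groupStructure` — line `purity_stacking`, crux
# `IsometryAtoms.MinimisingLawsCohesive` (stmt-AtomisticToContinuum-15777)

Helper file (registered sub-goal) for the structure theorem of discontinuous groups of isometries of
`ℝ³`: a FINITE group `Γ` of isometries of `E = EuclideanSpace ℝ (Fin 3)` has a common fixed point,
the centroid `|Γ|⁻¹ • ∑_{g ∈ Γ} g 0` of the orbit of the origin (used by the lead in the case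
"no translations and `Γ` finite" to produce the invariant point). Auxiliary lemmas live in the
sub-namespace `…GroupStructure.Centroid`.
-/

noncomputable section

open scoped RealInnerProductSpace
open Literature.Geometry.DiscreteGeometry.Crystallographic Module

namespace Summit.AtomisticToContinuum.Crystallization.Theorems.IsometryAtomsMinimisingLawsCohesive.GroupStructure

namespace Centroid

/-- Left translation reindexes the orbit sum: `∑_{g ∈ Γ} (h g) 0 = ∑_{g ∈ Γ} g 0` for `h ∈ Γ`. -/
theorem sum_mul_apply_zero_eq {Γ : Subgroup (EuclideanSpace ℝ (Fin 3) ≃ᵢ EuclideanSpace ℝ (Fin 3))}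
    [Fintype Γ] {h : EuclideanSpace ℝ (Fin 3) ≃ᵢ EuclideanSpace ℝ (Fin 3)} (hh : h ∈ Γ) :
    ∑ g : Γ, (h * (g : EuclideanSpace ℝ (Fin 3) ≃ᵢ EuclideanSpace ℝ (Fin 3))) 0
      = ∑ g : Γ, (g : EuclideanSpace ℝ (Fin 3) ≃ᵢ EuclideanSpace ℝ (Fin 3)) 0 := by
  have key := Equiv.sum_comp (Equiv.mulLeft (⟨h, hh⟩ : Γ))
    (fun g : Γ => (g : EuclideanSpace ℝ (Fin 3) ≃ᵢ EuclideanSpace ℝ (Fin 3)) 0)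
  simpa only [Equiv.coe_mulLeft, Subgroup.coe_mul] using key

/-- The linear part of `h` maps the orbit centroid of `0` to the centroid minus `h 0`:
`h (n⁻¹ • ∑ g 0) = n⁻¹ • ∑ (h g) 0` where `n = |Γ|`. -/
theorem apply_centroid_eq {Γ : Subgroup (EuclideanSpace ℝ (Fin 3) ≃ᵢ EuclideanSpace ℝ (Fin 3))}
    [Fintype Γ] (h : EuclideanSpace ℝ (Fin 3) ≃ᵢ EuclideanSpace ℝ (Fin 3)) :
    h ((Fintype.card Γ : ℝ)⁻¹ • ∑ g : Γ, (g : EuclideanSpace ℝ (Fin 3) ≃ᵢ EuclideanSpace ℝ (Fin 3)) 0)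
      = (Fintype.card Γ : ℝ)⁻¹ •
          ∑ g : Γ, (h * (g : EuclideanSpace ℝ (Fin 3) ≃ᵢ EuclideanSpace ℝ (Fin 3))) 0 := by
  have hn : (Fintype.card Γ : ℝ) ≠ 0 := by
    have : 0 < Fintype.card Γ := Fintype.card_pos
    exact_mod_cast this.ne'
  have hconst : ∑ _g : Γ, h 0 = (Fintype.card Γ : ℝ) • h 0 := by
    rw [Finset.sum_const, Finset.card_univ, Nat.cast_smul_eq_nsmul]
  calc h ((Fintype.card Γ : ℝ)⁻¹ •
          ∑ g : Γ, (g : EuclideanSpace ℝ (Fin 3) ≃ᵢ EuclideanSpace ℝ (Fin 3)) 0)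
      = h.toRealLinearIsometryEquiv ((Fintype.card Γ : ℝ)⁻¹ •
          ∑ g : Γ, (g : EuclideanSpace ℝ (Fin 3) ≃ᵢ EuclideanSpace ℝ (Fin 3)) 0) + h 0 :=
        apply_eq_lin_add h _
    _ = (Fintype.card Γ : ℝ)⁻¹ •
          ∑ g : Γ, h.toRealLinearIsometryEquiv
            ((g : EuclideanSpace ℝ (Fin 3) ≃ᵢ EuclideanSpace ℝ (Fin 3)) 0) + h 0 := by
        rw [LinearIsometryEquiv.map_smul, map_sum]
    _ = (Fintype.card Γ : ℝ)⁻¹ •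
          ∑ g : Γ, (h.toRealLinearIsometryEquiv
            ((g : EuclideanSpace ℝ (Fin 3) ≃ᵢ EuclideanSpace ℝ (Fin 3)) 0) + h 0) := by
        rw [Finset.sum_add_distrib, hconst, smul_add, smul_smul, inv_mul_cancel₀ hn, one_smul]
    _ = (Fintype.card Γ : ℝ)⁻¹ •
          ∑ g : Γ, (h * (g : EuclideanSpace ℝ (Fin 3) ≃ᵢ EuclideanSpace ℝ (Fin 3))) 0 := by
        simp only [mul_apply_zero]

end Centroid

/-- **Sub-goal `groupStructure_fixedPoint_of_finite`**: a finite group `Γ` of isometries of `ℝ³`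
has a common fixed point, namely the centroid `p = |Γ|⁻¹ • ∑_{g ∈ Γ} g 0` of the orbit of the origin:
for `h ∈ Γ`, `h p = L_h p + h 0 = |Γ|⁻¹ • ∑_g (L_h (g 0) + h 0) = |Γ|⁻¹ • ∑_g (h g) 0 = p`, the last
step by reindexing the sum along left multiplication by `h`. -/
theorem groupStructure_fixedPoint_of_finite : ∀ Γ : Subgroup (EuclideanSpace ℝ (Fin 3) ≃ᵢ EuclideanSpace ℝ (Fin 3)), Finite Γ → ∃ p : EuclideanSpace ℝ (Fin 3), ∀ g ∈ Γ, g p = p := by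
  intro Γ _
  classical
  haveI : Fintype Γ := Fintype.ofFinite Γ
  refine ⟨(Fintype.card Γ : ℝ)⁻¹ •
    ∑ g : Γ, (g : EuclideanSpace ℝ (Fin 3) ≃ᵢ EuclideanSpace ℝ (Fin 3)) 0, fun h hh => ?_⟩
  rw [Centroid.apply_centroid_eq h, Centroid.sum_mul_apply_zero_eq hh]

end Summit.AtomisticToContinuum.Crystallization.Theorems.IsometryAtomsMinimisingLawsCohesive.GroupStructure

end
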